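import Literature.Geometry.Kaehler.DDcForm
import Literature.Geometry.Kaehler.TwoPowPairFrame
import Literature.Geometry.Kaehler.LeviUnitaryDiag
import Literature.Geometry.Kaehler.HolomorphicChainRectifiable
import HarnessLib

/-!
# `(dd^c w)ᵖ` on the complex frame of a complex `p`-plane: `p! ∏ 2λᵢ ≥ 0`

Pointwise evaluation of the Monge–Ampère density of a real function `w` against a complex
`p`-plane `K` of a finite-dimensional complex inner product space `V` (the tangent plane of a
holomorphic chain): with `A = dd^c w (x)` (`Literature/Geometry/Kaehler/DDcForm.lean`) and the wedge
power `Aᵖ = A.twoPow p` (`TwoFormPowers.lean`),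

* `exists_orthonormal_twoPow_ddcForm_complexFrame` — **there is a unitary basis `u` of `K` and
  reals `λᵢ` with `Aᵖ(u₀, i u₀, …, u_{p-1}, i u_{p-1}) = p! ∏ᵢ (2 λᵢ)`**, the `λᵢ` being the
  eigenvalues of the Levi form `½ (D²w(a)(b) + D²w(i a)(i b))` on `K` (`LeviUnitaryDiag.lean` +
  `TwoPowPairFrame.lean`); they are `≥ 0` when the Levi form is `≥ 0` on `K`;
* `twoPow_ddcForm_complexFrame_eq_of_orthonormal` — the value `Aᵖ(complexFrame u)` does not depend
  on the unitary basis `u` of `K` (`frameVector_complexFrame_eq_of_orthonormal`), hence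
* `twoPow_ddcForm_complexFrame_nonneg` — **`(dd^c w)ᵖ ≥ 0` on the canonically oriented complex frame
  of every complex `p`-plane on which the Levi form of `w` is `≥ 0`** — the pointwise positivity of
  `[T] ∧ (dd^c w)ᵖ` for holomorphic chains and plurisubharmonic `w` [Chirka1989, §13.2 (positivity of
  `ωᵖ` on complex planes), §15.1]; [Demailly, Ch. III §1].

Theorems only.

## References

* E. M. Chirka, *Complex Analytic Sets*, Kluwer 1989, §13.2, §15.1 [Chirka1989].
* C. Voisin, *Hodge Theory and Complex Algebraic Geometry I*, §3.1.3 [VoisinHodgeI2002].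
-/

open scoped InnerProductSpace ComplexConjugate
open Complex Module Set

noncomputable section

namespace Literature.Geometry.Kaehler

variable {V : Type*} [NormedAddCommGroup V] [InnerProductSpace ℂ V]

/-! ### The Levi form of a symmetric bilinear form on a complex subspace -/

section Levi

variable (S : V →L[ℝ] V →L[ℝ] ℝ) (K : Submodule ℂ V)

/-- The **Levi form** `L(a, b) = ½ (S(a, b) + S(i a, i b))` of a real bilinear form `S` (the Hessian
`D²w(x)`), restricted to the complex subspace `K`, as a continuous real bilinear form on `K`.
[cite: Chirka1989, §13.2] -/
def leviOn : K →L[ℝ] K →L[ℝ] ℝ :=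
  LinearMap.mkContinuous₂
    (LinearMap.mk₂ ℝ (fun a b : K => (S (a : V) (b : V) + S (I • (a : V)) (I • (b : V))) / 2)
      (fun a a' b => by
        simp only [Submodule.coe_add, smul_add, map_add, add_apply]; ring)
      (fun r a b => by
        simp only [Submodule.coe_smul_of_tower, ← Complex.coe_smul, smul_comm I (r : ℂ) (a : V)]
        rw [Complex.coe_smul, Complex.coe_smul, S.map_smul, S.map_smul]
        simp only [smul_apply, smul_eq_mul]; ring)
      (fun a b b' => by simp only [Submodule.coe_add, smul_add, map_add]; ring)
      (fun r a b => by
        simp only [Submodule.coe_smul_of_tower, ← Complex.coe_smul, smul_comm I (r : ℂ) (b : V)]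
        rw [Complex.coe_smul, Complex.coe_smul, map_smul, map_smul]
        simp only [smul_eq_mul]; ring))
    ‖S‖ (fun a b => by
      have h1 : ‖S (a : V) (b : V)‖ ≤ ‖S‖ * ‖a‖ * ‖b‖ := S.le_opNorm₂ (a : V) (b : V)
      have h2 : ‖S (I • (a : V)) (I • (b : V))‖ ≤ ‖S‖ * ‖a‖ * ‖b‖ := by
        have := S.le_opNorm₂ (I • (a : V)) (I • (b : V))
        rwa [norm_smul, norm_smul, norm_I, one_mul, one_mul] at this
      simp only [LinearMap.mk₂_apply, Real.norm_eq_abs, abs_div, abs_two]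
      rw [Real.norm_eq_abs] at h1 h2
      have := abs_add_le (S (a : V) (b : V)) (S (I • (a : V)) (I • (b : V)))
      linarith)

/-- Unfolding: `leviOn S K a b = (S a b + S (i a) (i b)) / 2`. [folklore] -/
@[simp] theorem leviOn_apply (a b : K) :
    leviOn S K a b = (S (a : V) (b : V) + S (I • (a : V)) (I • (b : V))) / 2 := rfl

/-- The Levi form is `J`-invariant. [folklore] -/
theorem leviOn_I_smul (a b : K) : leviOn S K (I • a) (I • b) = leviOn S K a b := by
  simp only [leviOn_apply, Submodule.coe_smul, smul_smul, I_mul_I, neg_one_smul, map_neg,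
    neg_apply, neg_neg]
  ring

/-- The Levi form of a symmetric form is symmetric. [folklore] -/
theorem leviOn_symm (hsym : ∀ a b : V, S a b = S b a) (a b : K) : leviOn S K a b = leviOn S K b a := by
  simp only [leviOn_apply, hsym (a : V), hsym (I • (a : V))]

end Levi

/-! ### `dd^c w` on vectors of `K` through the Levi form -/

section Frame

variable {w : V → ℝ} {x : V}

/-- `(dd^c w)(a, b) = 2 L(b, i a)` for `a, b ∈ K`, `L` the Levi form of the Hessian on `K`.
[cite: Chirka1989, §13.2] -/
theorem ddcForm_apply_eq_two_mul_leviOn (hw : DifferentiableAt ℝ (fderiv ℝ w) x)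
    (hsym : ∀ a b : V, fderiv ℝ (fderiv ℝ w) x a b = fderiv ℝ (fderiv ℝ w) x b a)
    (K : Submodule ℂ V) (a b : K) :
    ddcForm w x ![(a : V), (b : V)] = 2 * leviOn (fderiv ℝ (fderiv ℝ w) x) K b (I • a) := by
  rw [ddcForm_apply_eq_hessian_add_hessian hw hsym, leviOn_apply, Submodule.coe_smul]
  ring

/-- Interleaving a `Fin p`-indexed frame through `ℕ`: the frame of `twoPow_apply_complexPairFrame`
for the extension by zero of `u` is `complexFrame u`. [folklore] -/
theorem complexFrame_eq_interleave {p : ℕ} (u : Fin p → V) :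
    complexFrame u = fun k : Fin (2 * p) =>
      if (k : ℕ) % 2 = 0 then (fun i : ℕ => if h : i < p then u ⟨i, h⟩ else 0) (k / 2)
      else I • (fun i : ℕ => if h : i < p then u ⟨i, h⟩ else 0) (k / 2) := by
  funext k
  have hk : (k : ℕ) / 2 < p := by omega
  simp only [complexFrame, Nat.even_iff, dif_pos hk]

/-- **`(dd^c w)ᵖ` on a diagonalising unitary basis of a complex `p`-plane.** Let the Hessian
`D²w(x)` be symmetric (e.g. `w` of class `C²` at `x`) and `K` a complex subspace of dimension `p`.
Then there are a unitary basis `u` of `K` and reals `λᵢ` — the eigenvalues of the Levi form of `w`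
on `K` — with `(dd^c w)ᵖ(u₀, i u₀, …, u_{p-1}, i u_{p-1}) = p! ∏ (2 λᵢ)`, and `λᵢ ≥ 0` whenever the
Levi form is `≥ 0` on `K` (`D²w(a)(a) + D²w(ia)(ia) ≥ 0` for `a ∈ K`).
[cite: Chirka1989, §13.2] -/
theorem exists_orthonormal_twoPow_ddcForm_complexFrame [FiniteDimensional ℂ V]
    (hw : DifferentiableAt ℝ (fderiv ℝ w) x)
    (hsym : ∀ a b : V, fderiv ℝ (fderiv ℝ w) x a b = fderiv ℝ (fderiv ℝ w) x b a)
    (K : Submodule ℂ V) {p : ℕ} (hK : finrank ℂ K = p) :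
    ∃ (u : Fin p → V) (ev : Fin p → ℝ), Orthonormal ℂ u ∧ (∀ i, u i ∈ K) ∧
      Submodule.span ℂ (range u) = K ∧
      (ddcForm w x).twoPow p (complexFrame u) = p.factorial * ∏ i, (2 * ev i) ∧
      ((∀ a ∈ K, 0 ≤ fderiv ℝ (fderiv ℝ w) x a a + fderiv ℝ (fderiv ℝ w) x (I • a) (I • a)) →
        ∀ i, 0 ≤ ev i) := by
  set S := fderiv ℝ (fderiv ℝ w) x with hS
  set L := leviOn S K with hL
  obtain ⟨b, ev, hdiag, hdiag', hpos⟩ :=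
    exists_orthonormalBasis_levi_diag (L := L) hK (leviOn_symm S K hsym) (leviOn_I_smul S K)
  have hLsymm : ∀ a c : K, L a c = L c a := leviOn_symm S K hsym
  have hLJ : ∀ a c : K, L (I • a) (I • c) = L a c := leviOn_I_smul S K
  set u : Fin p → V := fun i => (b i : V) with hu
  have huK : ∀ i, u i ∈ K := fun i => (b i).2
  have hon : Orthonormal ℂ u := b.orthonormal.comp_linearIsometry K.subtypeₗᵢ
  -- the relations of a weighted pair frame, with weights `2 ev i`
  set A := ddcForm w x with hA
  have key : ∀ (a c : K), A ![(a : V), (c : V)] = 2 * L c (I • a) := fun a c =>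
    ddcForm_apply_eq_two_mul_leviOn hw hsym K a c
  have huu : ∀ i j, i < p → j < p →
      A ![(fun i : ℕ => if h : i < p then u ⟨i, h⟩ else 0) i,
          (fun i : ℕ => if h : i < p then u ⟨i, h⟩ else 0) j] = 0 := by
    intro i j hi hj
    simp only [dif_pos hi, dif_pos hj, hu]
    rw [key, hdiag']
    ring
  have hJJ : ∀ i j, i < p → j < p →
      A ![I • (fun i : ℕ => if h : i < p then u ⟨i, h⟩ else 0) i,
          I • (fun i : ℕ => if h : i < p then u ⟨i, h⟩ else 0) j] = 0 := by
    intro i j hi hj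
    simp only [dif_pos hi, dif_pos hj, hu]
    have h1 : A ![I • ((b ⟨i, hi⟩ : K) : V), I • ((b ⟨j, hj⟩ : K) : V)] =
        A ![((I • b ⟨i, hi⟩ : K) : V), ((I • b ⟨j, hj⟩ : K) : V)] := by simp
    rw [h1, key, smul_smul, I_mul_I, neg_one_smul, map_neg, hLsymm, hdiag']
    ring
  have huJ : ∀ i j, i < p → j < p →
      A ![(fun i : ℕ => if h : i < p then u ⟨i, h⟩ else 0) i,
          I • (fun i : ℕ => if h : i < p then u ⟨i, h⟩ else 0) j] =
        if i = j then (fun i : ℕ => if h : i < p then 2 * ev ⟨i, h⟩ else 0) i else 0 := by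
    intro i j hi hj
    simp only [dif_pos hi, dif_pos hj, hu]
    have h1 : A ![((b ⟨i, hi⟩ : K) : V), I • ((b ⟨j, hj⟩ : K) : V)] =
        A ![((b ⟨i, hi⟩ : K) : V), ((I • b ⟨j, hj⟩ : K) : V)] := by simp
    rw [h1, key, hLJ, hLsymm, hdiag]
    by_cases hij : i = j
    · subst hij; simp
    · rw [if_neg (fun h => hij (by simpa using congrArg Fin.val h)), if_neg hij, mul_zero]
  have hmain := TwoForm.twoPow_apply_complexPairFrame A p
    (fun i : ℕ => if h : i < p then u ⟨i, h⟩ else 0)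
    (fun i : ℕ => if h : i < p then 2 * ev ⟨i, h⟩ else 0) huu hJJ huJ
  refine ⟨u, ev, hon, huK, ?_, ?_, fun hpsh i => hpos (fun a => ?_) i⟩
  · -- `span u = K`
    apply le_antisymm (Submodule.span_le.2 (by rintro _ ⟨i, rfl⟩; exact huK i))
    -- dimension count: `u` is linearly independent with `p = dim K` elements inside `K`
    have hli : LinearIndependent ℂ u := hon.linearIndependent
    have h1 : finrank ℂ (Submodule.span ℂ (range u)) = p := by
      rw [finrank_span_eq_card hli, Fintype.card_fin]
    exact Submodule.eq_of_le_of_finrank_le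
      (Submodule.span_le.2 (by rintro _ ⟨i, rfl⟩; exact huK i)) (by rw [hK, h1]) |>.ge
  · rw [complexFrame_eq_interleave, hmain]
    congr 1
    refine Finset.prod_congr rfl fun i _ => ?_
    simp only [dif_pos i.2, Fin.eta]
  · have := hpsh a a.2
    show 0 ≤ leviOn S K a a
    rw [leviOn_apply]
    linarith

/-- **Independence of the unitary basis.** The value of a real `2p`-covector on the complex frame
`(u₀, i u₀, …)` is the same for all unitary bases `u` of a given complex `p`-plane (two unitary frames
differ by a unitary matrix, whose realification has determinant `|det|² = 1`; the tree's
`frameVector_complexFrame_eq_of_orthonormal`). [folklore] -/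
theorem apply_complexFrame_eq_of_orthonormal {p : ℕ} (φ : V [⋀^Fin (2 * p)]→L[ℝ] ℝ)
    {u u' : Fin p → V} (hu : Orthonormal ℂ u) (hu' : Orthonormal ℂ u')
    (h : ∀ j, u' j ∈ Submodule.span ℂ (range u)) :
    φ (complexFrame u') = φ (complexFrame u) := by
  letI : InnerProductSpace ℝ V := InnerProductSpace.complexToReal
  have := frameVector_complexFrame_eq_of_orthonormal hu hu' h
  exact congrArg (fun ξ : Literature.Geometry.GeometricMeasureTheory.Multivector V (2 * p) => ξ φ) this

/-- **Positivity of `(dd^c w)ᵖ` on complex frames.** If the Hessian `D²w(x)` is symmetric and the Levi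
form of `w` at `x` is `≥ 0` on the complex `p`-plane `K` (`D²w(a)(a) + D²w(ia)(ia) ≥ 0` for `a ∈ K`;
e.g. `w` plurisubharmonic of class `C²`), then for EVERY unitary basis `u` of `K`,
`(dd^c w)ᵖ(u₀, i u₀, …, u_{p-1}, i u_{p-1}) ≥ 0`. This is the pointwise positivity of the measures
`[T] ∧ (dd^c w)ᵖ` for positive holomorphic `p`-chains `T`. [cite: Chirka1989, §13.2] -/
theorem twoPow_ddcForm_complexFrame_nonneg [FiniteDimensional ℂ V] (hw : DifferentiableAt ℝ (fderiv ℝ w) x)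
    (hsym : ∀ a b : V, fderiv ℝ (fderiv ℝ w) x a b = fderiv ℝ (fderiv ℝ w) x b a)
    (K : Submodule ℂ V) {p : ℕ} (hK : finrank ℂ K = p)
    (hpsh : ∀ a ∈ K, 0 ≤ fderiv ℝ (fderiv ℝ w) x a a + fderiv ℝ (fderiv ℝ w) x (I • a) (I • a))
    {u : Fin p → V} (hu : Orthonormal ℂ u) (huK : ∀ i, u i ∈ K) :
    0 ≤ (ddcForm w x).twoPow p (complexFrame u) := by
  obtain ⟨u₀, ev, hon, hu₀K, hspan, hval, hpos⟩ :=
    exists_orthonormal_twoPow_ddcForm_complexFrame hw hsym K hK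
  have hmem : ∀ j, u j ∈ Submodule.span ℂ (range u₀) := fun j => by rw [hspan]; exact huK j
  rw [apply_complexFrame_eq_of_orthonormal _ hon hu hmem, hval]
  refine mul_nonneg (Nat.cast_nonneg _) (Finset.prod_nonneg fun i _ => ?_)
  exact mul_nonneg zero_le_two (hpos hpsh i)

end Frame

end Literature.Geometry.Kaehler

end
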